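import Literature.Analysis.Hypoelliptic.KernelComposition
import Mathlib.MeasureTheory.Integral.Bochner.ContinuousLinearMap
import HarnessLib

/-!
# The `L²` pairing on the Fourier side: Cauchy–Schwarz between dual weights and adjoints of kernel operators

Analysis/Hypoelliptic support file, fourth piece of the Fourier-side toolkit serving the
discharge of `Literature.Analysis.Distribution.Hormander1967_thm11` by Kohn's method
(M. Taylor, *Pseudodifferential Operators* (1981), Ch. XV §1). Continues
`KernelComposition.lean`.

* `pairing F G = ∫ F ξ conj (G ξ) dξ` (for `F = 𝓕u`, `G = 𝓕v` this is `(u, v)_{L²}` by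
  Plancherel), the **duality of `H^s` and `H^{-s}`**:
  `‖pairing F G‖ ≤ wnorm s F · wnorm (-s) G`, integrability of the pairing integrand, the
  (sesqui)linearity rules and `pairing F F = ‖F‖₀²`.
* **Adjoints**: for a kernel `K` of order `m`, `F ∈ Ĥ^t` and `G ∈ Ĥ^{m-t}`,
  `pairing (kerOp K F) G = pairing F (kerOp K† G)` with `K†(ξ, η) = conj (K η ξ)` (Fubini; the
  absolute convergence of the double integral is the Schur estimate
  `∫∫ ‖G ξ‖ ‖K ξ η‖ ‖F η‖ ≤ schurConst · wnorm (m-t) G · wnorm t F`).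

## References

* M. E. Taylor, *Pseudodifferential Operators* (1981), Ch. II §6; Ch. XV §1.
-/

noncomputable section

open MeasureTheory Set Filter Function
open scoped ENNReal NNReal Topology ComplexConjugate

namespace Literature.Analysis.Hypoelliptic

variable {V : Type*} [NormedAddCommGroup V] [InnerProductSpace ℝ V] [FiniteDimensional ℝ V]
  [MeasurableSpace V] [BorelSpace V]

/-! ### The pairing and the duality `Ĥ^s × Ĥ^{-s}` -/

/-- The `L²` pairing on the Fourier side, `pairing F G = ∫ F ξ conj (G ξ) dξ` (a Bochner
integral; `0` if not integrable). [folklore] -/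
def pairing (F G : V → ℂ) : ℂ :=
  ∫ ξ, F ξ * conj (G ξ)

/-- The pairing only sees a.e. classes. [folklore] -/
theorem pairing_congr_ae {F F' G G' : V → ℂ} (hF : F =ᵐ[volume] F') (hG : G =ᵐ[volume] G') :
    pairing F G = pairing F' G' :=
  integral_congr_ae (hF.mp (hG.mono fun ξ h1 h2 => by simp only [h1, h2]))

/-- **Cauchy–Schwarz between dual weights**: `∫ ‖F‖ ‖G‖ ≤ wnorm s F · wnorm (-s) G`.
[folklore] -/
theorem lintegral_mul_le_wnorm_mul (s : ℝ) {F G : V → ℂ} (hF : AEStronglyMeasurable F volume)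
    (hG : AEStronglyMeasurable G volume) :
    ∫⁻ ξ, ‖F ξ‖ₑ * ‖G ξ‖ₑ ≤ wnorm s F * wnorm (-s) G := by
  set f : V → ℝ≥0∞ := fun ξ => ENNReal.ofReal (bw s ξ) * ‖F ξ‖ₑ with hf
  set g : V → ℝ≥0∞ := fun ξ => ENNReal.ofReal (bw (-s) ξ) * ‖G ξ‖ₑ with hg
  have h1 : ∀ ξ, ‖F ξ‖ₑ * ‖G ξ‖ₑ = (f * g) ξ := fun ξ => by
    simp only [hf, hg, Pi.mul_apply]
    calc ‖F ξ‖ₑ * ‖G ξ‖ₑ = (ENNReal.ofReal (bw s ξ) * ENNReal.ofReal (bw (-s) ξ)) *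
          (‖F ξ‖ₑ * ‖G ξ‖ₑ) := by
            rw [← ENNReal.ofReal_mul (bw_nonneg _ _), bw_mul_bw_neg, ENNReal.ofReal_one,
              one_mul]
      _ = _ := by ring
  have hfm : AEMeasurable f volume :=
    (ENNReal.measurable_ofReal.comp (measurable_bw s)).aemeasurable.mul hF.enorm
  have hgm : AEMeasurable g volume :=
    (ENNReal.measurable_ofReal.comp (measurable_bw (-s))).aemeasurable.mul hG.enorm
  have hCS := ENNReal.lintegral_mul_le_Lp_mul_Lq volume Real.HolderConjugate.two_two hfm hgm
  simp only [one_div] at hCS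
  calc ∫⁻ ξ, ‖F ξ‖ₑ * ‖G ξ‖ₑ = ∫⁻ ξ, (f * g) ξ := lintegral_congr h1
    _ ≤ (∫⁻ ξ, f ξ ^ (2 : ℝ)) ^ (2⁻¹ : ℝ) * (∫⁻ ξ, g ξ ^ (2 : ℝ)) ^ (2⁻¹ : ℝ) := hCS
    _ = wnorm s F * wnorm (-s) G := by
        rw [wnorm_eq_lintegral, wnorm_eq_lintegral]
        simp only [hf, hg, ENNReal.rpow_two]

/-- The pairing integrand of `F ∈ Ĥ^s`, `G ∈ Ĥ^{-s}` is integrable. [folklore] -/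
theorem integrable_pairing {s : ℝ} {F G : V → ℂ} (hF : InH s F) (hG : InH (-s) G) :
    Integrable (fun ξ => F ξ * conj (G ξ)) volume := by
  refine ⟨hF.1.mul (Complex.continuous_conj.comp_aestronglyMeasurable hG.1), ?_⟩
  rw [hasFiniteIntegral_iff_enorm]
  calc ∫⁻ ξ, ‖F ξ * conj (G ξ)‖ₑ = ∫⁻ ξ, ‖F ξ‖ₑ * ‖G ξ‖ₑ := lintegral_congr fun ξ => by
        rw [enorm_mul, ← ofReal_norm (conj (G ξ)), Complex.norm_conj, ofReal_norm]
    _ ≤ wnorm s F * wnorm (-s) G := lintegral_mul_le_wnorm_mul s hF.1 hG.1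
    _ < ∞ := ENNReal.mul_lt_top hF.2 hG.2

/-- **Duality of `Ĥ^s` and `Ĥ^{-s}`**: `‖pairing F G‖ ≤ wnorm s F · wnorm (-s) G`.
[folklore] -/
theorem norm_pairing_le {s : ℝ} {F G : V → ℂ} (hF : InH s F) (hG : InH (-s) G) :
    ‖pairing F G‖ ≤ (wnorm s F).toReal * (wnorm (-s) G).toReal := by
  have h1 : ‖pairing F G‖ₑ ≤ wnorm s F * wnorm (-s) G := by
    refine (enorm_integral_le_lintegral_enorm _).trans ?_
    calc ∫⁻ ξ, ‖F ξ * conj (G ξ)‖ₑ = ∫⁻ ξ, ‖F ξ‖ₑ * ‖G ξ‖ₑ := lintegral_congr fun ξ => by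
          rw [enorm_mul, ← ofReal_norm (conj (G ξ)), Complex.norm_conj, ofReal_norm]
      _ ≤ _ := lintegral_mul_le_wnorm_mul s hF.1 hG.1
  rw [← ENNReal.toReal_mul, ← toReal_enorm]
  exact ENNReal.toReal_mono (ENNReal.mul_ne_top hF.2.ne hG.2.ne) h1

/-- `pairing G F = conj (pairing F G)`. [folklore] -/
theorem pairing_comm (F G : V → ℂ) : pairing G F = conj (pairing F G) := by
  rw [pairing, pairing, ← integral_conj]
  exact integral_congr_ae (Eventually.of_forall fun ξ => by simp [mul_comm])

/-- Moving a multiplier across the pairing: `pairing (φ F) G = pairing F (conj φ · G)`.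
[folklore] -/
theorem pairing_mul_left (φ F G : V → ℂ) :
    pairing (fun ξ => φ ξ * F ξ) G = pairing F (fun ξ => conj (φ ξ) * G ξ) := by
  unfold pairing
  refine integral_congr_ae (Eventually.of_forall fun ξ => ?_)
  simp only [map_mul, Complex.conj_conj]
  ring

/-- Scalars on the left. [folklore] -/
theorem pairing_const_mul_left (c : ℂ) (F G : V → ℂ) :
    pairing (fun ξ => c * F ξ) G = c * pairing F G := by
  unfold pairing
  rw [← integral_const_mul]
  exact integral_congr_ae (Eventually.of_forall fun ξ => by ring)

/-- Scalars on the right. [folklore] -/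
theorem pairing_const_mul_right (c : ℂ) (F G : V → ℂ) :
    pairing F (fun ξ => c * G ξ) = conj c * pairing F G := by
  unfold pairing
  rw [← integral_const_mul]
  exact integral_congr_ae (Eventually.of_forall fun ξ => by simp only [map_mul]; ring)

/-- Negation on the left. [folklore] -/
theorem pairing_neg_left (F G : V → ℂ) : pairing (fun ξ => -F ξ) G = -pairing F G := by
  have h := pairing_const_mul_left (-1) F G
  simpa using h

/-- Negation on the right. [folklore] -/
theorem pairing_neg_right (F G : V → ℂ) : pairing F (fun ξ => -G ξ) = -pairing F G := by
  have h := pairing_const_mul_right (-1) F G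
  simpa using h

/-- Additivity on the left (for integrable pairings). [folklore] -/
theorem pairing_add_left {s : ℝ} {F₁ F₂ G : V → ℂ} (h₁ : InH s F₁) (h₂ : InH s F₂)
    (hG : InH (-s) G) :
    pairing (fun ξ => F₁ ξ + F₂ ξ) G = pairing F₁ G + pairing F₂ G := by
  unfold pairing
  rw [← integral_add (integrable_pairing h₁ hG) (integrable_pairing h₂ hG)]
  exact integral_congr_ae (Eventually.of_forall fun ξ => by ring)

/-- Subtractivity on the left. [folklore] -/
theorem pairing_sub_left {s : ℝ} {F₁ F₂ G : V → ℂ} (h₁ : InH s F₁) (h₂ : InH s F₂)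
    (hG : InH (-s) G) :
    pairing (fun ξ => F₁ ξ - F₂ ξ) G = pairing F₁ G - pairing F₂ G := by
  unfold pairing
  rw [← integral_sub (integrable_pairing h₁ hG) (integrable_pairing h₂ hG)]
  exact integral_congr_ae (Eventually.of_forall fun ξ => by ring)

/-- Additivity on the right. [folklore] -/
theorem pairing_add_right {s : ℝ} {F G₁ G₂ : V → ℂ} (hF : InH s F) (h₁ : InH (-s) G₁)
    (h₂ : InH (-s) G₂) :
    pairing F (fun ξ => G₁ ξ + G₂ ξ) = pairing F G₁ + pairing F G₂ := by
  unfold pairing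
  rw [← integral_add (integrable_pairing hF h₁) (integrable_pairing hF h₂)]
  exact integral_congr_ae (Eventually.of_forall fun ξ => by simp only [map_add]; ring)

/-- Subtractivity on the right. [folklore] -/
theorem pairing_sub_right {s : ℝ} {F G₁ G₂ : V → ℂ} (hF : InH s F) (h₁ : InH (-s) G₁)
    (h₂ : InH (-s) G₂) :
    pairing F (fun ξ => G₁ ξ - G₂ ξ) = pairing F G₁ - pairing F G₂ := by
  unfold pairing
  rw [← integral_sub (integrable_pairing hF h₁) (integrable_pairing hF h₂)]
  exact integral_congr_ae (Eventually.of_forall fun ξ => by simp only [map_sub]; ring)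

/-- `wnorm 0 F = ‖F‖_{L²}`. [folklore] -/
theorem wnorm_zero_eq_eLpNorm (F : V → ℂ) : wnorm 0 F = eLpNorm F 2 volume := by
  unfold wnorm
  congr 1
  ext ξ
  simp

/-- **`pairing F F = ‖F‖₀²`** for `F ∈ Ĥ^0 = L²`. [folklore] -/
theorem pairing_self {F : V → ℂ} (hF : InH 0 F) :
    pairing F F = (((wnorm 0 F).toReal ^ 2 : ℝ) : ℂ) := by
  have hmem : MemLp F 2 volume := ⟨hF.1, by rw [← wnorm_zero_eq_eLpNorm]; exact hF.2⟩
  have h1 : pairing F F = ((∫ ξ, ‖F ξ‖ ^ 2 : ℝ) : ℂ) := by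
    rw [pairing, ← integral_complex_ofReal]
    refine integral_congr_ae (Eventually.of_forall fun ξ => ?_)
    simp only
    rw [Complex.mul_conj, Complex.normSq_eq_norm_sq]
  rw [h1, wnorm_zero_eq_eLpNorm,
    hmem.eLpNorm_eq_integral_rpow_norm two_ne_zero ENNReal.ofNat_ne_top]
  simp only [ENNReal.toReal_ofNat, Real.rpow_two]
  have hnn : 0 ≤ ∫ ξ, ‖F ξ‖ ^ 2 := integral_nonneg fun ξ => sq_nonneg _
  rw [ENNReal.toReal_ofReal (Real.rpow_nonneg hnn _), ← one_div, ← Real.sqrt_eq_rpow,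
    Real.sq_sqrt hnn]

/-- The real part of `pairing F F` is `‖F‖₀²` and it is real. [folklore] -/
theorem pairing_self_re {F : V → ℂ} (hF : InH 0 F) :
    (pairing F F).re = (wnorm 0 F).toReal ^ 2 := by
  rw [pairing_self hF, Complex.ofReal_re]

/-! ### Adjoints of kernel operators -/

/-- **The Schur estimate for the absolute double integral**:
`∫ ‖G ξ‖ (∫ ‖K ξ η‖ ‖F η‖ dη) dξ ≤ schurConst (t - m) C · wnorm (m - t) G · wnorm t F` for a
kernel of order `m`. [folklore] -/
theorem KerDecay.lintegral_lintegral_le {K : V → V → ℂ} {m : ℝ} {C : ℕ → ℝ} (h : KerDecay K m C)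
    (t : ℝ) {F G : V → ℂ} (hF : AEStronglyMeasurable F volume)
    (hG : AEStronglyMeasurable G volume) :
    ∫⁻ ξ, ‖G ξ‖ₑ * ∫⁻ η, ‖K ξ η‖ₑ * ‖F η‖ₑ ≤
      ENNReal.ofReal (schurConst V (t - m) C) * wnorm (m - t) G * wnorm t F := by
  -- measurable modifications
  obtain ⟨F', hF'm, hFF'⟩ := hF
  obtain ⟨G', hG'm, hGG'⟩ := hG
  have hF' : Measurable F' := hF'm.measurable
  have hG' : Measurable G' := hG'm.measurable
  have hinF : ∀ ξ, ∫⁻ η, ‖K ξ η‖ₑ * ‖F η‖ₑ = ∫⁻ η, ‖K ξ η‖ₑ * ‖F' η‖ₑ := fun ξ =>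
    lintegral_congr_ae (hFF'.mono fun η hη => by simp only [hη])
  have hLHS : ∫⁻ ξ, ‖G ξ‖ₑ * ∫⁻ η, ‖K ξ η‖ₑ * ‖F η‖ₑ =
      ∫⁻ ξ, ‖G' ξ‖ₑ * ∫⁻ η, ‖K ξ η‖ₑ * ‖F' η‖ₑ :=
    lintegral_congr_ae (hGG'.mono fun ξ hξ => by simp only [hξ, hinF])
  rw [hLHS, wnorm_congr_ae (s := m - t) hGG', wnorm_congr_ae (s := t) hFF']
  -- notation as in `wnorm_kerOp_le`
  set a : ℝ := t - m with ha
  set N : ℕ := decayIndex V a with hN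
  set c₀ : ℝ := 2 ^ (|a| / 2) * C N with hc₀
  have hc₀nn : 0 ≤ c₀ := mul_nonneg (by positivity) (h.nonneg N)
  set k : V → ℝ≥0∞ := fun ζ => ENNReal.ofReal (c₀ * bw (|a| - N) ζ) with hk
  set GF : V → ℝ≥0∞ := fun η => ENNReal.ofReal (bw t η) * ‖F' η‖ₑ with hGF
  set GG : V → ℝ≥0∞ := fun ξ => ENNReal.ofReal (bw (-a) ξ) * ‖G' ξ‖ₑ with hGG
  have hGFm : Measurable GF := (ENNReal.measurable_ofReal.comp (measurable_bw t)).mul hF'.enorm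
  have hGGm : Measurable GG :=
    (ENNReal.measurable_ofReal.comp (measurable_bw (-a))).mul hG'.enorm
  set Kd : V → V → ℝ≥0∞ := fun ξ η => ENNReal.ofReal (bw a ξ) * ‖K ξ η‖ₑ *
    ENNReal.ofReal (bw (-t) η) with hKd
  have hKdm : Measurable (uncurry Kd) :=
    ((ENNReal.measurable_ofReal.comp ((measurable_bw a).comp measurable_fst)).mul
      h.measurable.enorm).mul (ENNReal.measurable_ofReal.comp ((measurable_bw (-t)).comp
        measurable_snd))
  have hKdk : ∀ ξ η, Kd ξ η ≤ k (ξ - η) := fun ξ η => by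
    simp only [hKd, hk]
    rw [← ofReal_norm, ← ENNReal.ofReal_mul (bw_nonneg a ξ),
      ← ENNReal.ofReal_mul (mul_nonneg (bw_nonneg a ξ) (norm_nonneg _))]
    refine ENNReal.ofReal_le_ofReal ?_
    have hw := h.weighted_bound t N ξ η
    calc bw a ξ * ‖K ξ η‖ * bw (-t) η
        ≤ (2 ^ (|a| / 2) * C N * bw (|a| - N) (ξ - η) * bw t η) * bw (-t) η :=
          mul_le_mul_of_nonneg_right hw (bw_nonneg _ _)
      _ = c₀ * bw (|a| - N) (ξ - η) * (bw t η * bw (-t) η) := by rw [hc₀]; ring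
      _ = c₀ * bw (|a| - N) (ξ - η) := by rw [bw_mul_bw_neg, mul_one]
  -- the inner integral in terms of `Kd` and `GF`
  have h1 : ∀ η : V, ENNReal.ofReal (bw (-t) η) * ENNReal.ofReal (bw t η) = 1 := fun η => by
    rw [← ENNReal.ofReal_mul (bw_nonneg (-t) η), mul_comm, bw_mul_bw_neg, ENNReal.ofReal_one]
  have h2 : ∀ ξ : V, ENNReal.ofReal (bw (-a) ξ) * ENNReal.ofReal (bw a ξ) = 1 := fun ξ => by
    rw [← ENNReal.ofReal_mul (bw_nonneg (-a) ξ), mul_comm, bw_mul_bw_neg, ENNReal.ofReal_one]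
  have hinner : ∀ ξ, ‖G' ξ‖ₑ * ∫⁻ η, ‖K ξ η‖ₑ * ‖F' η‖ₑ = GG ξ * ∫⁻ η, Kd ξ η * GF η := by
    intro ξ
    have hI : ∫⁻ η, Kd ξ η * GF η = ENNReal.ofReal (bw a ξ) * ∫⁻ η, ‖K ξ η‖ₑ * ‖F' η‖ₑ := by
      rw [← lintegral_const_mul' _ _ ENNReal.ofReal_ne_top]
      refine lintegral_congr fun η => ?_
      simp only [hKd, hGF]
      calc ENNReal.ofReal (bw a ξ) * ‖K ξ η‖ₑ * ENNReal.ofReal (bw (-t) η) *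
            (ENNReal.ofReal (bw t η) * ‖F' η‖ₑ)
          = ENNReal.ofReal (bw a ξ) * ‖K ξ η‖ₑ *
              (ENNReal.ofReal (bw (-t) η) * ENNReal.ofReal (bw t η)) * ‖F' η‖ₑ := by ring
        _ = ENNReal.ofReal (bw a ξ) * (‖K ξ η‖ₑ * ‖F' η‖ₑ) := by rw [h1, mul_one, mul_assoc]
    rw [hI]
    simp only [hGG]
    calc ‖G' ξ‖ₑ * ∫⁻ η, ‖K ξ η‖ₑ * ‖F' η‖ₑ
        = (ENNReal.ofReal (bw (-a) ξ) * ENNReal.ofReal (bw a ξ)) *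
            (‖G' ξ‖ₑ * ∫⁻ η, ‖K ξ η‖ₑ * ‖F' η‖ₑ) := by rw [h2, one_mul]
      _ = _ := by ring
  -- Cauchy–Schwarz in `ξ`, then Schur
  have hJm : Measurable fun ξ => ∫⁻ η, Kd ξ η * GF η :=
    (hKdm.mul (hGFm.comp measurable_snd)).lintegral_prod_right
  have hCS := ENNReal.lintegral_mul_le_Lp_mul_Lq volume Real.HolderConjugate.two_two
    hGGm.aemeasurable hJm.aemeasurable
  simp only [one_div] at hCS
  have hS := schur_test_conv hKdm hKdk hGFm
  have hint : ∫⁻ ζ, k ζ = ENNReal.ofReal c₀ * ∫⁻ ζ : V, ENNReal.ofReal (bw (|a| - N) ζ) := by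
    have hmeas : Measurable fun ζ : V => ENNReal.ofReal (bw (|a| - N) ζ) :=
      ENNReal.measurable_ofReal.comp (measurable_bw _)
    simp only [hk]
    rw [← lintegral_const_mul'' _ hmeas.aemeasurable]
    exact lintegral_congr fun ζ => ENNReal.ofReal_mul hc₀nn
  have hIfin : ∫⁻ ζ : V, ENNReal.ofReal (bw (|a| - N) ζ) < ∞ := lintegral_bw_decayIndex_lt_top a
  have hkS : ∫⁻ ζ, k ζ = ENNReal.ofReal (schurConst V a C) := by
    rw [hint, schurConst, ← hN, ← hc₀, ENNReal.ofReal_mul hc₀nn, ENNReal.ofReal_toReal hIfin.ne]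
  have hGGn : (∫⁻ ξ, GG ξ ^ (2 : ℝ)) ^ (2⁻¹ : ℝ) = wnorm (m - t) G' := by
    rw [wnorm_eq_lintegral, show m - t = -a by rw [ha]; ring]
    simp only [hGG, ENNReal.rpow_two]
  have hGFn : (∫⁻ η, GF η ^ 2) = wnorm t F' ^ 2 := by
    rw [wnorm_sq]
  calc ∫⁻ ξ, ‖G' ξ‖ₑ * ∫⁻ η, ‖K ξ η‖ₑ * ‖F' η‖ₑ
      = ∫⁻ ξ, (GG * fun ξ => ∫⁻ η, Kd ξ η * GF η) ξ := lintegral_congr hinner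
    _ ≤ (∫⁻ ξ, GG ξ ^ (2 : ℝ)) ^ (2⁻¹ : ℝ) *
          (∫⁻ ξ, (∫⁻ η, Kd ξ η * GF η) ^ (2 : ℝ)) ^ (2⁻¹ : ℝ) := hCS
    _ ≤ wnorm (m - t) G' * ((∫⁻ ζ, k ζ) ^ 2 * ∫⁻ η, GF η ^ 2) ^ (2⁻¹ : ℝ) := by
        rw [hGGn]
        refine mul_le_mul' le_rfl (ENNReal.rpow_le_rpow ?_ (by norm_num))
        simpa only [ENNReal.rpow_two] using hS
    _ = wnorm (m - t) G' * ((∫⁻ ζ, k ζ) * wnorm t F') := by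
        rw [hGFn, ← mul_pow, ENNReal.sq_rpow_inv_two]
    _ = ENNReal.ofReal (schurConst V a C) * wnorm (m - t) G' * wnorm t F' := by
        rw [hkS]; ring

/-- Finiteness of the absolute double integral for `F ∈ Ĥ^t`, `G ∈ Ĥ^{m-t}`. [folklore] -/
theorem KerDecay.lintegral_lintegral_lt_top {K : V → V → ℂ} {m : ℝ} {C : ℕ → ℝ}
    (h : KerDecay K m C) {t : ℝ} {F G : V → ℂ} (hF : InH t F) (hG : InH (m - t) G) :
    ∫⁻ ξ, ‖G ξ‖ₑ * ∫⁻ η, ‖K ξ η‖ₑ * ‖F η‖ₑ < ∞ :=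
  (h.lintegral_lintegral_le t hF.1 hG.1).trans_lt
    (ENNReal.mul_lt_top (ENNReal.mul_lt_top ENNReal.ofReal_lt_top hG.2) hF.2)

/-- The integrand of the adjoint identity is integrable on `V × V`. [folklore] -/
theorem KerDecay.integrable_pairing_integrand {K : V → V → ℂ} {m : ℝ} {C : ℕ → ℝ}
    (h : KerDecay K m C) {t : ℝ} {F G : V → ℂ} (hF : Measurable F) (hG : Measurable G)
    (hFt : wnorm t F < ∞) (hGt : wnorm (m - t) G < ∞) :
    Integrable (uncurry fun ξ η => K ξ η * F η * conj (G ξ)) (volume.prod volume) := by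
  have hFi : InH t F := ⟨hF.aestronglyMeasurable, hFt⟩
  have hfm : AEStronglyMeasurable (uncurry fun ξ η => K ξ η * F η * conj (G ξ))
      (volume.prod volume) := by
    refine (Measurable.stronglyMeasurable ?_).aestronglyMeasurable
    exact (h.measurable.mul (hF.comp measurable_snd)).mul
      (Complex.continuous_conj.measurable.comp (hG.comp measurable_fst))
  rw [integrable_prod_iff hfm]
  constructor
  · exact Eventually.of_forall fun ξ =>
      (h.integrable_mul hF.aestronglyMeasurable hFt ξ).mul_const (conj (G ξ))
  · have hrow : ∀ ξ, ∫ η, ‖uncurry (fun ξ η => K ξ η * F η * conj (G ξ)) (ξ, η)‖ =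
        (∫ η, ‖K ξ η * F η‖) * ‖G ξ‖ := fun ξ => by
      simp only [uncurry, norm_mul, Complex.norm_conj]
      exact integral_mul_const _ _
    refine ⟨hfm.norm.integral_prod_right', ?_⟩
    rw [hasFiniteIntegral_iff_enorm]
    calc ∫⁻ ξ, ‖∫ η, ‖uncurry (fun ξ η => K ξ η * F η * conj (G ξ)) (ξ, η)‖‖ₑ
        = ∫⁻ ξ, ‖G ξ‖ₑ * ∫⁻ η, ‖K ξ η‖ₑ * ‖F η‖ₑ := lintegral_congr fun ξ => by
          rw [hrow, enorm_mul, enorm_norm, mul_comm, Real.enorm_eq_ofReal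
            (integral_nonneg fun _ => norm_nonneg _),
            ofReal_integral_norm_eq_lintegral_enorm (h.integrable_mul hF.aestronglyMeasurable hFt ξ)]
          congr 1
          exact lintegral_congr fun η => enorm_mul _ _
      _ < ∞ := h.lintegral_lintegral_lt_top hFi ⟨hG.aestronglyMeasurable, hGt⟩

/-- **The adjoint identity**: `pairing (kerOp K F) G = pairing F (kerOp K† G)` for a kernel of
order `m`, `F ∈ Ĥ^t`, `G ∈ Ĥ^{m-t}` (`K† = adjKer K`). [folklore] -/
theorem KerDecay.pairing_kerOp_left {K : V → V → ℂ} {m : ℝ} {C : ℕ → ℝ} (h : KerDecay K m C)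
    {t : ℝ} {F G : V → ℂ} (hF : InH t F) (hG : InH (m - t) G) :
    pairing (kerOp K F) G = pairing F (kerOp (adjKer K) G) := by
  -- measurable modifications
  obtain ⟨F', hF'm, hFF'⟩ := hF.1
  obtain ⟨G', hG'm, hGG'⟩ := hG.1
  have hF't : wnorm t F' < ∞ := by rw [← wnorm_congr_ae hFF']; exact hF.2
  have hG't : wnorm (m - t) G' < ∞ := by rw [← wnorm_congr_ae hGG']; exact hG.2
  rw [kerOp_congr_ae K hFF', kerOp_congr_ae (adjKer K) hGG',
    pairing_congr_ae (Eventually.of_forall fun _ => rfl) hGG', pairing_congr_ae hFF'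
      (Eventually.of_forall fun _ => rfl)]
  have hF' : Measurable F' := hF'm.measurable
  have hG' : Measurable G' := hG'm.measurable
  have hint := h.integrable_pairing_integrand hF' hG' hF't hG't
  have hswap := integral_integral_swap hint
  -- left-hand side
  have hL : pairing (kerOp K F') G' = ∫ ξ, ∫ η, K ξ η * F' η * conj (G' ξ) := by
    simp only [pairing, kerOp]
    refine integral_congr_ae (Eventually.of_forall fun ξ => ?_)
    exact (integral_mul_const _ _).symm
  -- right-hand side
  have hR : pairing F' (kerOp (adjKer K) G') = ∫ η, ∫ ξ, K ξ η * F' η * conj (G' ξ) := by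
    simp only [pairing, kerOp, adjKer]
    refine integral_congr_ae (Eventually.of_forall fun η => ?_)
    simp only
    rw [← integral_conj, ← integral_const_mul]
    refine integral_congr_ae (Eventually.of_forall fun ξ => ?_)
    simp only [map_mul, Complex.conj_conj]
    ring
  rw [hL, hR, hswap]

/-- The adjoint identity with the kernel operator on the right:
`pairing F (kerOp K G) = pairing (kerOp K† F) G` for `G ∈ Ĥ^t`, `F ∈ Ĥ^{m-t}`. [folklore] -/
theorem KerDecay.pairing_kerOp_right {K : V → V → ℂ} {m : ℝ} {C : ℕ → ℝ} (h : KerDecay K m C)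
    {t : ℝ} {F G : V → ℂ} (hG : InH t G) (hF : InH (m - t) F) :
    pairing F (kerOp K G) = pairing (kerOp (adjKer K) F) G := by
  rw [pairing_comm, h.pairing_kerOp_left hG hF, ← pairing_comm]

end Literature.Analysis.Hypoelliptic
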